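import Summits.RiemannHypothesis.RiemannHypothesis.Theorems.SemilocalDeletionCliff
import Summits.RiemannHypothesis.RiemannHypothesis.Theorems.HandoffSemilocalEnergy
import HarnessLib

/-!
# The SCHUR (orbit-graph) floor for multi-prime deletions of the semi-local Weil forms

Deleting a SET `D` of primes from `S` (each `p ∈ D` with `log p > c`, so each is a single visible atom on the window of
`k = g ⋆ g̃`, `g ∈ C(c)`) changes the semi-local form by `Q_{S∖D}(g) − Q_S(g) = Σ_{p∈D} (log p/√p)·(k(log p) + k(−log p))`
(§2, exact).  `SemilocalDeletionCliffMulti.lean` bounded the cost by the SUM `Σ_{p∈D} log p/√p`; the cell's numerics (cc-s2-1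
gen9 LG18, handoff-idea-1 g11–g12 PRED-CLIFF19-ORBIT PART O, 32/32 certified cells, BLIND) show the true cost is the smaller
ORBIT-GRAPH radius `ρ(D, c)`: the lags `log p` act on the window `[−c, c]` by translation, and only CHAINS of lags that stay
inside the window can conspire.  This file proves the mechanism as a SCHUR TEST: for every weight `φ ≥ 0`, bounded, with
`φ ≥ m > 0` on the window,

  `Re Q_{S∖D}(g) ≥ Re Q_S(g) − ρ·‖g‖₂²`  whenever  `Σ_{p∈D} (log p/√p)·(φ(x − log p) + φ(x + log p)) ≤ ρ·φ(x)` on `[−c, c]`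

(§3 `re_weilSemilocalQuadratic_sdiff_ge_of_schur`; energy form §4 `semilocalGroundEnergy_sdiff_ge_of_schur`).  The weight
`φ = 𝟙_{[−c,c]}` gives back the sum floor (no two of `x ± log p` lie in the window when `c < log p`); the Perron vector of the
orbit graph of `D` on `[−c, c]` gives `ρ = ` its spectral radius (Collatz–Wielandt), i.e. idea-1's floor, instance by instance.
§5 (appended): the bound is TWO-SIDED, `|λ_min(S∖D; c; P) − λ_min(S; c; P)| ≤ ρ`.
The analytic core (§1) is the weighted sliver bound `2|k(L)| ≤ ∫ |g(x)|²·(φ(x − L) + φ(x + L))/φ(x) dx` (weighted AM–GM under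
the integral, Schur's test for the translation pair `T_{±L}` compressed to the window).  Nothing here bears on RH.
-/

set_option linter.dupNamespace false

noncomputable section

open Complex Filter Set MeasureTheory
open scoped Real Topology ComplexConjugate

namespace Summit.RiemannHypothesis.RiemannHypothesis.Theorems.SemilocalDeletionSchurFloor

open Literature.NumberTheory.LFunctions
open Summit.RiemannHypothesis.RiemannHypothesis.Theorems.SemilocalDeletionCliff
open Summit.RiemannHypothesis.RiemannHypothesis.Theorems.HandoffSemilocalEnergy

variable {g : ℝ → ℂ} {φ : ℝ → ℝ} {m M L c : ℝ}

/-! ## §1  The weighted sliver bound (Schur test for one lag) -/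

/-- Weighted AM–GM: for reals `a, b` and `s, t > 0`, `2ab ≤ (t/s)·a² + (s/t)·b²`. -/
theorem two_mul_le_weighted {a b s t : ℝ} (hs : 0 < s) (ht : 0 < t) :
    2 * a * b ≤ t / s * a ^ 2 + s / t * b ^ 2 := by
  have h := two_mul_le_add_sq (Real.sqrt (t / s) * a) (Real.sqrt (s / t) * b)
  have hst : Real.sqrt (t / s) * Real.sqrt (s / t) = 1 := by
    rw [← Real.sqrt_mul (div_nonneg ht.le hs.le), div_mul_div_comm, mul_comm t s, div_self (by positivity),
      Real.sqrt_one]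
  have e1 : 2 * (Real.sqrt (t / s) * a) * (Real.sqrt (s / t) * b) = 2 * a * b := by
    calc 2 * (Real.sqrt (t / s) * a) * (Real.sqrt (s / t) * b)
        = 2 * a * b * (Real.sqrt (t / s) * Real.sqrt (s / t)) := by ring
      _ = 2 * a * b := by rw [hst, mul_one]
  rw [e1, mul_pow, mul_pow, Real.sq_sqrt (div_nonneg ht.le hs.le), Real.sq_sqrt (div_nonneg hs.le ht.le)] at h
  exact h

/-- Pointwise Schur step: if `φ ≥ 0` everywhere and `φ > 0` wherever `g ≠ 0`, then for all `u`
`2|g(u)|·|g(u − L)| ≤ (φ(u − L)/φ(u))·|g(u)|² + (φ(u)/φ(u − L))·|g(u − L)|²`. -/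
theorem two_mul_norm_mul_norm_le (hφ0 : ∀ x, 0 ≤ φ x) (hφpos : ∀ x, g x ≠ 0 → 0 < φ x) (u L : ℝ) :
    2 * ‖g u‖ * ‖g (u - L)‖ ≤ φ (u - L) / φ u * ‖g u‖ ^ 2 + φ u / φ (u - L) * ‖g (u - L)‖ ^ 2 := by
  by_cases h1 : g u = 0
  · rw [h1, norm_zero, mul_zero, zero_mul]
    have := hφ0 u; have := hφ0 (u - L); positivity
  by_cases h2 : g (u - L) = 0
  · rw [h2, norm_zero, mul_zero]
    have := hφ0 u; have := hφ0 (u - L); positivity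
  exact two_mul_le_weighted (hφpos u h1) (hφpos (u - L) h2)

/-- **Weighted sliver bound (one lag).** For a Weil test function `g` and a measurable weight `φ` with `0 ≤ φ ≤ M` and
`φ ≥ m > 0` on `tsupport g`: `2‖k(L)‖ ≤ ∫ |g(x)|²·(φ(x − L) + φ(x + L))/φ(x) dx`, `k = g ⋆ g̃`. -/
theorem two_mul_norm_weilConv_weilReflect_le (hg : IsWeilTest g) (hφ : Measurable φ) (hφ0 : ∀ x, 0 ≤ φ x)
    (hφM : ∀ x, φ x ≤ M) (hm : 0 < m) (hφm : ∀ x ∈ tsupport g, m ≤ φ x) (L : ℝ) :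
    2 * ‖weilConv g (weilReflect g) L‖ ≤ ∫ x : ℝ, ‖g x‖ ^ 2 * ((φ (x - L) + φ (x + L)) / φ x) := by
  have hφpos : ∀ x, g x ≠ 0 → 0 < φ x := fun x hx ↦
    hm.trans_le (hφm x (subset_tsupport _ (Function.mem_support.2 hx)))
  have hi2 : Integrable fun x : ℝ ↦ ‖g x‖ ^ 2 := hg.integrable_norm_sq
  -- the two weighted integrands are dominated by (M/m)|g|²
  have hdom : ∀ s : ℝ, Integrable fun x : ℝ ↦ φ (x + s) / φ x * ‖g x‖ ^ 2 := by
    intro s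
    refine Integrable.mono' (hi2.const_mul (M / m)) ?_ (Eventually.of_forall fun x ↦ ?_)
    · exact ((hφ.comp (measurable_id.add_const s)).div hφ).aestronglyMeasurable.mul hi2.aestronglyMeasurable
    · rw [Real.norm_eq_abs, abs_mul, abs_of_nonneg (sq_nonneg ‖g x‖)]
      by_cases hx : g x = 0
      · simp [hx]
      · have hφx := hφpos x hx
        rw [abs_of_nonneg (div_nonneg (hφ0 _) hφx.le)]
        have h1 : φ (x + s) / φ x ≤ M / m :=
          div_le_div₀ (le_trans (hφ0 x) (hφM x)) (hφM _) hm
            (hφm x (subset_tsupport _ (Function.mem_support.2 hx)))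
        exact mul_le_mul_of_nonneg_right h1 (sq_nonneg _)
  have hA := hdom (-L)
  have hB := hdom L
  simp only [← sub_eq_add_neg] at hA
  -- pointwise bound on the integrand of k(L)
  rw [weilConv_apply]
  have hpt : ∀ u : ℝ, ‖g u * weilReflect g (L - u)‖ ≤
      (φ (u - L) / φ u * ‖g u‖ ^ 2 + φ u / φ (u - L) * ‖g (u - L)‖ ^ 2) / 2 := by
    intro u
    simp only [weilReflect, norm_mul, Complex.norm_conj, neg_sub]
    have := two_mul_norm_mul_norm_le hφ0 hφpos u L
    linarith
  have hshift : ∫ u : ℝ, φ u / φ (u - L) * ‖g (u - L)‖ ^ 2 = ∫ x : ℝ, φ (x + L) / φ x * ‖g x‖ ^ 2 := by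
    have := integral_sub_right_eq_self (μ := (volume : Measure ℝ)) (fun x : ℝ ↦ φ (x + L) / φ x * ‖g x‖ ^ 2) L
    simp only [sub_add_cancel] at this
    exact this
  have hB' : Integrable fun u : ℝ ↦ φ u / φ (u - L) * ‖g (u - L)‖ ^ 2 := by
    have := hB.comp_sub_right L
    simp only [sub_add_cancel] at this
    exact this
  calc 2 * ‖∫ u : ℝ, g u * weilReflect g (L - u)‖
      ≤ 2 * ∫ u : ℝ, ‖g u * weilReflect g (L - u)‖ :=
        mul_le_mul_of_nonneg_left (norm_integral_le_integral_norm _) (by norm_num)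
    _ ≤ 2 * ∫ u : ℝ, (φ (u - L) / φ u * ‖g u‖ ^ 2 + φ u / φ (u - L) * ‖g (u - L)‖ ^ 2) / 2 :=
        mul_le_mul_of_nonneg_left
          (integral_mono_of_nonneg (Eventually.of_forall fun _ ↦ norm_nonneg _) ((hA.add hB').div_const 2)
            (Eventually.of_forall hpt)) (by norm_num)
    _ = (∫ u : ℝ, φ (u - L) / φ u * ‖g u‖ ^ 2) + ∫ u : ℝ, φ u / φ (u - L) * ‖g (u - L)‖ ^ 2 := by
        rw [integral_div, integral_add hA hB']; ring
    _ = ∫ x : ℝ, ‖g x‖ ^ 2 * ((φ (x - L) + φ (x + L)) / φ x) := by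
        rw [hshift, ← integral_add hA hB]
        congr 1 with x
        ring

/-- Both lags at once: `‖k(L) + k(−L)‖ ≤ ∫ |g(x)|²·(φ(x − L) + φ(x + L))/φ(x) dx` (`‖k(−L)‖ = ‖k(L)‖`). -/
theorem norm_weilConv_weilReflect_add_neg_le_schur (hg : IsWeilTest g) (hφ : Measurable φ) (hφ0 : ∀ x, 0 ≤ φ x)
    (hφM : ∀ x, φ x ≤ M) (hm : 0 < m) (hφm : ∀ x ∈ tsupport g, m ≤ φ x) (L : ℝ) :
    ‖weilConv g (weilReflect g) L + weilConv g (weilReflect g) (-L)‖ ≤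
      ∫ x : ℝ, ‖g x‖ ^ 2 * ((φ (x - L) + φ (x + L)) / φ x) := by
  have h := two_mul_norm_weilConv_weilReflect_le hg hφ hφ0 hφM hm hφm L
  have h' : ‖weilConv g (weilReflect g) (-L)‖ = ‖weilConv g (weilReflect g) L‖ := by
    have := congrArg (fun z : ℂ ↦ ‖z‖) (conj_weilConv_weilReflect_neg g L)
    simpa only [Complex.norm_conj] using this
  calc ‖weilConv g (weilReflect g) L + weilConv g (weilReflect g) (-L)‖
      ≤ ‖weilConv g (weilReflect g) L‖ + ‖weilConv g (weilReflect g) (-L)‖ := norm_add_le _ _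
    _ ≤ _ := by rw [h']; linarith


/-- The weighted energy density `|g(x)|²·(φ(x − L) + φ(x + L))/φ(x)` is integrable (dominated by `(2M/m)|g|²`). -/
theorem integrable_norm_sq_mul_schurWeight (hg : IsWeilTest g) (hφ : Measurable φ) (hφ0 : ∀ x, 0 ≤ φ x)
    (hφM : ∀ x, φ x ≤ M) (hm : 0 < m) (hφm : ∀ x ∈ tsupport g, m ≤ φ x) (L : ℝ) :
    Integrable fun x : ℝ ↦ ‖g x‖ ^ 2 * ((φ (x - L) + φ (x + L)) / φ x) := by
  have hφpos : ∀ x, g x ≠ 0 → 0 < φ x := fun x hx ↦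
    hm.trans_le (hφm x (subset_tsupport _ (Function.mem_support.2 hx)))
  have hi2 : Integrable fun x : ℝ ↦ ‖g x‖ ^ 2 := hg.integrable_norm_sq
  refine Integrable.mono' (hi2.const_mul (2 * M / m)) ?_ (Eventually.of_forall fun x ↦ ?_)
  · exact hi2.aestronglyMeasurable.mul
      (((hφ.comp (measurable_id.sub_const L)).add (hφ.comp (measurable_id.add_const L))).div hφ).aestronglyMeasurable
  · rw [Real.norm_eq_abs, abs_mul, abs_of_nonneg (sq_nonneg ‖g x‖)]
    by_cases hx : g x = 0
    · simp [hx]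
    · have hφx := hφpos x hx
      rw [abs_of_nonneg (div_nonneg (add_nonneg (hφ0 _) (hφ0 _)) hφx.le)]
      have h1 : (φ (x - L) + φ (x + L)) / φ x ≤ 2 * M / m :=
        div_le_div₀ (by linarith [hφ0 (x - L), hφM (x - L)]) (by linarith [hφM (x - L), hφM (x + L)]) hm
          (hφm x (subset_tsupport _ (Function.mem_support.2 hx)))
      calc ‖g x‖ ^ 2 * ((φ (x - L) + φ (x + L)) / φ x) ≤ ‖g x‖ ^ 2 * (2 * M / m) :=
            mul_le_mul_of_nonneg_left h1 (sq_nonneg _)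
        _ = 2 * M / m * ‖g x‖ ^ 2 := by ring

/-! ## §2  Deleting a set of single atoms, exactly -/

variable {S D : Finset ℕ}

/-- **Multi-deletion identity.** For a finite set `D ⊆ S` of primes with `c < log p` for all `p ∈ D` and `g ∈ C(c)`:
`Q_{S∖D}(g) = Q_S(g) + Σ_{p∈D} (log p/√p)·(k(log p) + k(−log p))`, `k = g ⋆ g̃`. -/
theorem weilSemilocalQuadratic_sdiff_eq (hg : IsWeilTest g) (hsupp : tsupport g ⊆ Icc (-c) c)
    (D : Finset ℕ) {S : Finset ℕ} (hDS : D ⊆ S) (hprime : ∀ p ∈ D, p.Prime) (hlog : ∀ p ∈ D, c < Real.log p) :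
    weilSemilocalQuadratic (S \ D) g = weilSemilocalQuadratic S g +
      ∑ p ∈ D, ((Real.log p / Real.sqrt p : ℝ) : ℂ) *
        (weilConv g (weilReflect g) (Real.log p) + weilConv g (weilReflect g) (-Real.log p)) := by
  classical
  induction D using Finset.induction_on generalizing S with
  | empty => simp
  | @insert p D hpD ih =>
    have hpS : p ∈ S := hDS (Finset.mem_insert_self p D)
    have hp : p.Prime := hprime p (Finset.mem_insert_self p D)
    have hcp : c < Real.log p := hlog p (Finset.mem_insert_self p D)
    have h1 := weilSemilocalQuadratic_sub_erase hg hp hpS hsupp hcp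
    have hDS' : D ⊆ S.erase p := by
      intro q hq
      exact Finset.mem_erase.2 ⟨fun h ↦ hpD (h ▸ hq), hDS (Finset.mem_insert_of_mem hq)⟩
    have h2 := ih hDS' (fun q hq ↦ hprime q (Finset.mem_insert_of_mem hq))
      (fun q hq ↦ hlog q (Finset.mem_insert_of_mem hq))
    have hset : S.erase p \ D = S \ insert p D := by
      ext q
      simp only [Finset.mem_sdiff, Finset.mem_erase, Finset.mem_insert, not_or]
      tauto
    rw [hset] at h2
    rw [h2, Finset.sum_insert hpD]
    linear_combination (-1 : ℂ) * h1

/-! ## §3  The Schur floor -/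

variable {ρ : ℝ}

/-- **THE SCHUR FLOOR.** Let `D ⊆ S` be primes with `c < log p` (`p ∈ D`), `g ∈ C(c)` a Weil test function, and `φ` a
measurable weight with `0 ≤ φ ≤ M` and `φ ≥ m > 0` on `[−c, c]` satisfying the Schur inequality
`Σ_{p∈D} (log p/√p)·(φ(x − log p) + φ(x + log p)) ≤ ρ·φ(x)` for every `x ∈ [−c, c]`.  Then
`Re Q_{S∖D}(g) ≥ Re Q_S(g) − ρ·‖g‖₂²`. -/
theorem re_weilSemilocalQuadratic_sdiff_ge_of_schur (hg : IsWeilTest g) (hsupp : tsupport g ⊆ Icc (-c) c)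
    (D : Finset ℕ) {S : Finset ℕ} (hDS : D ⊆ S) (hprime : ∀ p ∈ D, p.Prime) (hlog : ∀ p ∈ D, c < Real.log p)
    (hφ : Measurable φ) (hφ0 : ∀ x, 0 ≤ φ x) (hφM : ∀ x, φ x ≤ M) (hm : 0 < m) (hφm : ∀ x ∈ Icc (-c) c, m ≤ φ x)
    (hρ : ∀ x ∈ Icc (-c) c,
      ∑ p ∈ D, Real.log p / Real.sqrt p * (φ (x - Real.log p) + φ (x + Real.log p)) ≤ ρ * φ x) :
    (weilSemilocalQuadratic S g).re - ρ * ∫ x : ℝ, ‖g x‖ ^ 2 ≤ (weilSemilocalQuadratic (S \ D) g).re := by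
  have hφm' : ∀ x ∈ tsupport g, m ≤ φ x := fun x hx ↦ hφm x (hsupp hx)
  set F : ℕ → ℝ → ℝ := fun p x ↦ ‖g x‖ ^ 2 * ((φ (x - Real.log p) + φ (x + Real.log p)) / φ x) with hF
  have hFi : ∀ p, Integrable (F p) := fun p ↦ integrable_norm_sq_mul_schurWeight hg hφ hφ0 hφM hm hφm' _
  -- Re of the identity
  have hid := congrArg Complex.re (weilSemilocalQuadratic_sdiff_eq hg hsupp D hDS hprime hlog)
  rw [Complex.add_re, Complex.re_sum] at hid
  -- termwise: w_p · Re K_p ≥ −w_p ∫ F_p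
  have hterm : ∀ p ∈ D, -(Real.log p / Real.sqrt p * ∫ x : ℝ, F p x) ≤
      (((Real.log p / Real.sqrt p : ℝ) : ℂ) *
        (weilConv g (weilReflect g) (Real.log p) + weilConv g (weilReflect g) (-Real.log p))).re := by
    intro p hp
    have hw : 0 ≤ Real.log p / Real.sqrt p :=
      div_nonneg (Real.log_nonneg (by exact_mod_cast (hprime p hp).one_lt.le)) (Real.sqrt_nonneg _)
    have hK := norm_weilConv_weilReflect_add_neg_le_schur hg hφ hφ0 hφM hm hφm' (Real.log p)
    have hre := abs_re_le_norm
      (weilConv g (weilReflect g) (Real.log p) + weilConv g (weilReflect g) (-Real.log p))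
    rw [Complex.re_ofReal_mul]
    have := (abs_le.1 (hre.trans hK)).1
    nlinarith
  have hsum := Finset.sum_le_sum hterm
  -- Σ_p w_p ∫ F_p = ∫ Σ_p w_p F_p ≤ ∫ ρ |g|²
  have hswap : ∑ p ∈ D, Real.log p / Real.sqrt p * ∫ x : ℝ, F p x =
      ∫ x : ℝ, ∑ p ∈ D, Real.log p / Real.sqrt p * F p x := by
    rw [integral_finsetSum _ fun p _ ↦ (hFi p).const_mul _]
    simp only [integral_const_mul]
  have hpt : ∀ x : ℝ, ∑ p ∈ D, Real.log p / Real.sqrt p * F p x ≤ ρ * ‖g x‖ ^ 2 := by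
    intro x
    by_cases hx : g x = 0
    · simp [hF, hx]
    · have hxW : x ∈ Icc (-c) c := hsupp (subset_tsupport _ (Function.mem_support.2 hx))
      have hφx : 0 < φ x := hm.trans_le (hφm x hxW)
      have e : ∑ p ∈ D, Real.log p / Real.sqrt p * F p x =
          ‖g x‖ ^ 2 * ((∑ p ∈ D, Real.log p / Real.sqrt p * (φ (x - Real.log p) + φ (x + Real.log p))) / φ x) := by
        rw [Finset.sum_div, Finset.mul_sum]
        refine Finset.sum_congr rfl fun p _ ↦ ?_
        simp only [hF]
        ring
      rw [e, mul_comm ρ]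
      exact mul_le_mul_of_nonneg_left ((div_le_iff₀ hφx).2 (hρ x hxW)) (sq_nonneg _)
  have hint : ∫ x : ℝ, ∑ p ∈ D, Real.log p / Real.sqrt p * F p x ≤ ∫ x : ℝ, ρ * ‖g x‖ ^ 2 :=
    integral_mono (integrable_finsetSum _ fun p _ ↦ (hFi p).const_mul _) (hg.integrable_norm_sq.const_mul ρ)
      hpt
  rw [integral_const_mul] at hint
  have hneg : -(∑ p ∈ D, Real.log p / Real.sqrt p * ∫ x : ℝ, F p x) ≤
      ∑ p ∈ D, (((Real.log p / Real.sqrt p : ℝ) : ℂ) *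
        (weilConv g (weilReflect g) (Real.log p) + weilConv g (weilReflect g) (-Real.log p))).re := by
    rw [← Finset.sum_neg_distrib]; exact hsum
  linarith

/-- The sum floor of `SemilocalDeletionCliffMulti` as the Schur floor of the weight `φ = 𝟙_{[−c,c]}`: when `c < log p` for
every `p ∈ D`, at most ONE of `x ± log p` lies in the window, so `ρ = Σ_{p∈D} log p/√p` is admissible. -/
theorem re_weilSemilocalQuadratic_sdiff_ge_sum (hg : IsWeilTest g) (hsupp : tsupport g ⊆ Icc (-c) c)
    (D : Finset ℕ) {S : Finset ℕ} (hDS : D ⊆ S) (hprime : ∀ p ∈ D, p.Prime) (hlog : ∀ p ∈ D, c < Real.log p) :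
    (weilSemilocalQuadratic S g).re - (∑ p ∈ D, Real.log p / Real.sqrt p) * ∫ x : ℝ, ‖g x‖ ^ 2 ≤
      (weilSemilocalQuadratic (S \ D) g).re := by
  refine re_weilSemilocalQuadratic_sdiff_ge_of_schur hg hsupp D hDS hprime hlog (φ := (Icc (-c) c).indicator 1)
    (M := 1) (m := 1) (measurable_one.indicator measurableSet_Icc)
    (fun x ↦ Set.indicator_nonneg (fun _ _ ↦ zero_le_one) x)
    (fun x ↦ Set.indicator_apply_le' (fun _ ↦ le_rfl) fun _ ↦ zero_le_one) zero_lt_one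
    (fun x hx ↦ by rw [Set.indicator_of_mem hx]; simp) fun x hx ↦ ?_
  rw [Set.indicator_of_mem hx, Pi.one_apply, mul_one]
  refine Finset.sum_le_sum fun p hp ↦ ?_
  have hw : 0 ≤ Real.log p / Real.sqrt p :=
    div_nonneg (Real.log_nonneg (by exact_mod_cast (hprime p hp).one_lt.le)) (Real.sqrt_nonneg _)
  have hcp := hlog p hp
  rw [mem_Icc] at hx
  have hone : (Icc (-c) c).indicator (1 : ℝ → ℝ) (x - Real.log p) + (Icc (-c) c).indicator 1 (x + Real.log p) ≤ 1 := by
    by_cases h1 : x - Real.log p ∈ Icc (-c) c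
    · have h2 : x + Real.log p ∉ Icc (-c) c := by
        rw [mem_Icc] at h1 ⊢; push Not; intro _; linarith [h1.1]
      rw [Set.indicator_of_mem h1, Set.indicator_of_notMem h2]; simp
    · rw [Set.indicator_of_notMem h1, zero_add]
      exact Set.indicator_apply_le' (fun _ ↦ le_rfl) fun _ ↦ zero_le_one
  calc Real.log p / Real.sqrt p *
        ((Icc (-c) c).indicator (1 : ℝ → ℝ) (x - Real.log p) + (Icc (-c) c).indicator 1 (x + Real.log p))
      ≤ Real.log p / Real.sqrt p * 1 := mul_le_mul_of_nonneg_left hone hw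
    _ = Real.log p / Real.sqrt p := mul_one _

/-! ## §4  Energy language -/

variable {P : (ℝ → ℂ) → Prop}

/-- **Schur floor for the bottoms.** Under the hypotheses of `re_weilSemilocalQuadratic_sdiff_ge_of_schur` (a Schur weight `φ`
with constant `ρ ≥ 0` for `D` on `[−c, c]`): `λ_min(S∖D; c; P) ≥ λ_min(S; c; P) − ρ` for every constraint `P`. -/
theorem semilocalGroundEnergy_sdiff_ge_of_schur (D : Finset ℕ) {S : Finset ℕ} (hDS : D ⊆ S) (hprime : ∀ p ∈ D, p.Prime)
    (hlog : ∀ p ∈ D, c < Real.log p) (hφ : Measurable φ) (hφ0 : ∀ x, 0 ≤ φ x) (hφM : ∀ x, φ x ≤ M) (hm : 0 < m)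
    (hφm : ∀ x ∈ Icc (-c) c, m ≤ φ x) (hρ0 : 0 ≤ ρ)
    (hρ : ∀ x ∈ Icc (-c) c,
      ∑ p ∈ D, Real.log p / Real.sqrt p * (φ (x - Real.log p) + φ (x + Real.log p)) ≤ ρ * φ x) :
    semilocalGroundEnergy S P c - ρ ≤ semilocalGroundEnergy (S \ D) P c := by
  rcases (semilocalSphereValues (S \ D) P c).eq_empty_or_nonempty with he | hne
  · have he' : semilocalSphereValues S P c = ∅ := by
      rcases (semilocalSphereValues S P c).eq_empty_or_nonempty with h0 | h0
      · exact h0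
      · have := (semilocalSphereValues_nonempty_iff S P c).1 h0
        rw [← semilocalSphereValues_nonempty_iff (S \ D) P c, he] at this
        exact absurd this Set.not_nonempty_empty
    rw [semilocalGroundEnergy, semilocalGroundEnergy, he, he', Real.sInf_empty]
    linarith
  · refine le_semilocalGroundEnergy hne fun g hg hs hPg hn ↦ ?_
    have h1 := re_weilSemilocalQuadratic_sdiff_ge_of_schur hg hs D hDS hprime hlog hφ hφ0 hφM hm hφm hρ
    have h2 := semilocalGroundEnergy_le_re (S := S) hg hs hPg hn
    rw [hn, mul_one] at h1
    linarith

/-! ## §5  The Schur bound is two-sided: deletion moves every bottom by at most `ρ` in either direction -/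

/-- **Upper side of the Schur bound.** Under the hypotheses of `re_weilSemilocalQuadratic_sdiff_ge_of_schur`:
`Re Q_{S∖D}(g) ≤ Re Q_S(g) + ρ·‖g‖₂²` — the weighted sliver bound controls `|k(log p) + k(−log p)|`, so the same weight bounds the
change of the form from above as well (the data: the bottom always DROPS, to ≈ −ρ; this says it can never move by more than `ρ`). -/
theorem re_weilSemilocalQuadratic_sdiff_le_of_schur (hg : IsWeilTest g) (hsupp : tsupport g ⊆ Icc (-c) c)
    (D : Finset ℕ) {S : Finset ℕ} (hDS : D ⊆ S) (hprime : ∀ p ∈ D, p.Prime) (hlog : ∀ p ∈ D, c < Real.log p)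
    (hφ : Measurable φ) (hφ0 : ∀ x, 0 ≤ φ x) (hφM : ∀ x, φ x ≤ M) (hm : 0 < m) (hφm : ∀ x ∈ Icc (-c) c, m ≤ φ x)
    (hρ : ∀ x ∈ Icc (-c) c,
      ∑ p ∈ D, Real.log p / Real.sqrt p * (φ (x - Real.log p) + φ (x + Real.log p)) ≤ ρ * φ x) :
    (weilSemilocalQuadratic (S \ D) g).re ≤ (weilSemilocalQuadratic S g).re + ρ * ∫ x : ℝ, ‖g x‖ ^ 2 := by
  have hφm' : ∀ x ∈ tsupport g, m ≤ φ x := fun x hx ↦ hφm x (hsupp hx)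
  set F : ℕ → ℝ → ℝ := fun p x ↦ ‖g x‖ ^ 2 * ((φ (x - Real.log p) + φ (x + Real.log p)) / φ x) with hF
  have hFi : ∀ p, Integrable (F p) := fun p ↦ integrable_norm_sq_mul_schurWeight hg hφ hφ0 hφM hm hφm' _
  have hid := congrArg Complex.re (weilSemilocalQuadratic_sdiff_eq hg hsupp D hDS hprime hlog)
  rw [Complex.add_re, Complex.re_sum] at hid
  have hterm : ∀ p ∈ D, (((Real.log p / Real.sqrt p : ℝ) : ℂ) *
        (weilConv g (weilReflect g) (Real.log p) + weilConv g (weilReflect g) (-Real.log p))).re ≤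
      Real.log p / Real.sqrt p * ∫ x : ℝ, F p x := by
    intro p hp
    have hw : 0 ≤ Real.log p / Real.sqrt p :=
      div_nonneg (Real.log_nonneg (by exact_mod_cast (hprime p hp).one_lt.le)) (Real.sqrt_nonneg _)
    have hK := norm_weilConv_weilReflect_add_neg_le_schur hg hφ hφ0 hφM hm hφm' (Real.log p)
    have hre := abs_re_le_norm
      (weilConv g (weilReflect g) (Real.log p) + weilConv g (weilReflect g) (-Real.log p))
    rw [Complex.re_ofReal_mul]
    have := (abs_le.1 (hre.trans hK)).2
    nlinarith
  have hsum := Finset.sum_le_sum hterm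
  have hswap : ∑ p ∈ D, Real.log p / Real.sqrt p * ∫ x : ℝ, F p x =
      ∫ x : ℝ, ∑ p ∈ D, Real.log p / Real.sqrt p * F p x := by
    rw [integral_finsetSum _ fun p _ ↦ (hFi p).const_mul _]
    simp only [integral_const_mul]
  have hpt : ∀ x : ℝ, ∑ p ∈ D, Real.log p / Real.sqrt p * F p x ≤ ρ * ‖g x‖ ^ 2 := by
    intro x
    by_cases hx : g x = 0
    · simp [hF, hx]
    · have hxW : x ∈ Icc (-c) c := hsupp (subset_tsupport _ (Function.mem_support.2 hx))
      have hφx : 0 < φ x := hm.trans_le (hφm x hxW)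
      have e : ∑ p ∈ D, Real.log p / Real.sqrt p * F p x =
          ‖g x‖ ^ 2 * ((∑ p ∈ D, Real.log p / Real.sqrt p * (φ (x - Real.log p) + φ (x + Real.log p))) / φ x) := by
        rw [Finset.sum_div, Finset.mul_sum]
        refine Finset.sum_congr rfl fun p _ ↦ ?_
        simp only [hF]
        ring
      rw [e, mul_comm ρ]
      exact mul_le_mul_of_nonneg_left ((div_le_iff₀ hφx).2 (hρ x hxW)) (sq_nonneg _)
  have hint : ∫ x : ℝ, ∑ p ∈ D, Real.log p / Real.sqrt p * F p x ≤ ∫ x : ℝ, ρ * ‖g x‖ ^ 2 :=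
    integral_mono (integrable_finsetSum _ fun p _ ↦ (hFi p).const_mul _) (hg.integrable_norm_sq.const_mul ρ) hpt
  rw [integral_const_mul] at hint
  rw [hswap] at hsum
  linarith

/-- **Two-sided energy form**: with `ρ ≥ 0` as in `semilocalGroundEnergy_sdiff_ge_of_schur`, also
`λ_min(S∖D; c; P) ≤ λ_min(S; c; P) + ρ`; hence `|λ_min(S∖D; c; P) − λ_min(S; c; P)| ≤ ρ` for every constraint `P`. -/
theorem semilocalGroundEnergy_sdiff_le_of_schur (D : Finset ℕ) {S : Finset ℕ} (hDS : D ⊆ S) (hprime : ∀ p ∈ D, p.Prime)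
    (hlog : ∀ p ∈ D, c < Real.log p) (hφ : Measurable φ) (hφ0 : ∀ x, 0 ≤ φ x) (hφM : ∀ x, φ x ≤ M) (hm : 0 < m)
    (hφm : ∀ x ∈ Icc (-c) c, m ≤ φ x) (hρ0 : 0 ≤ ρ)
    (hρ : ∀ x ∈ Icc (-c) c,
      ∑ p ∈ D, Real.log p / Real.sqrt p * (φ (x - Real.log p) + φ (x + Real.log p)) ≤ ρ * φ x) :
    semilocalGroundEnergy (S \ D) P c ≤ semilocalGroundEnergy S P c + ρ := by
  rcases (semilocalSphereValues S P c).eq_empty_or_nonempty with he | hne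
  · have he' : semilocalSphereValues (S \ D) P c = ∅ := by
      rcases (semilocalSphereValues (S \ D) P c).eq_empty_or_nonempty with h0 | h0
      · exact h0
      · have := (semilocalSphereValues_nonempty_iff (S \ D) P c).1 h0
        rw [← semilocalSphereValues_nonempty_iff S P c, he] at this
        exact absurd this Set.not_nonempty_empty
    rw [semilocalGroundEnergy, semilocalGroundEnergy, he, he', Real.sInf_empty]
    linarith
  · have key : semilocalGroundEnergy (S \ D) P c - ρ ≤ semilocalGroundEnergy S P c := by
      refine le_semilocalGroundEnergy hne fun g hg hs hPg hn ↦ ?_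
      have h1 := re_weilSemilocalQuadratic_sdiff_le_of_schur hg hs D hDS hprime hlog hφ hφ0 hφM hm hφm hρ
      have h2 := semilocalGroundEnergy_le_re (S := S \ D) hg hs hPg hn
      rw [hn, mul_one] at h1
      linarith
    linarith

end Summit.RiemannHypothesis.RiemannHypothesis.Theorems.SemilocalDeletionSchurFloor

end

-- Build note (cc-s2-1 gen13, 2026-08-24T09:25Z): comment-only re-land under lead ruling R14-3 (1) to trigger the missing hub
-- build of this module (p374942 accepted 04:02Z, no olean since); every declaration above is byte-identical.
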